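import Literature.Geometry.Lorentzian.SpacetimeKretschmannScalar
import Literature.Geometry.Lorentzian.CoordCylinderDeformationPointwise
import HarnessLib

/-!
# An `ε`-flat chart sees only `O(ε²)` Kretschmann curvature

Let `Ψ : ↥O → 𝓢` be a smooth chart of a spacetime `𝓢` on an open set `O ⊆ E4`, read against the
Minkowski background `Minkowski.backgroundOn O` (`KerrConvergence.lean`: deviation
`Ψ^* g − η`, extended by zero to `E4` as `deviationExtend`). If at a point `x ∈ O` the `2`-jet of
the deviation is small, `‖Dᵐ(Ψ^* g − η)(x)‖ ≤ ε` for `m ≤ 2` with `ε ≤ 1/16`, then the Kretschmann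
scalar of `𝓢` at `Ψ x` is `O(ε²)`:

  `|Kretschmann(Ψ x)| ≤ 4⁵ · 42² · 8¹² · ε²`

(`Spacetime.abs_kretschmannAt_le_of_jets_deviationExtend_le`). In the vocabulary of late-time
charts (`deviationCk`, the `C²` sup norm of the deviation over a slab `{x⁰ = τ} ∩ O`): if
`deviationCk (Minkowski.backgroundOn O) Ψ 2 τ ≤ ε ≤ 1/16` then `|Kretschmann| ≤ C ε²` at the image
of every point of that slab (`Spacetime.abs_kretschmannAt_le_of_deviationCk_le`). This is the first
Lean-able piece of the "curvature wall" step (s3c) of the idea `horizon-shadowed-bag` for the crux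
`LaminatedThreshold` of the Final State Conjecture routes (triage `TRIAGE-r2-1.md`, sharpen (3):
"`ε`-flat chart points have Kretschmann `≤ Cε²`"): a region where the Kretschmann scalar stays
above `κ₀ > 0` cannot meet the late image of an `ε`-flat chart once `C ε² < κ₀`.

Proof: the components `G = metricInCoords (Ψ ∘ (chartAt E4 x).symm)` of the associated
parametrisation are `η + (Ψ^* g − η)` near `x` (`BackgroundChartCalculus`), so their `2`-jet is
`ε`-close to the CONSTANT field `η`, which is flat (`riemAt_const`); `‖♯_η‖ ≤ 4`
(`MetricCoord.norm_sharpAt_minkowski_le`) and `‖♯_G(x)‖ ≤ 8` (`norm_sharpAt_le_two_mul_of_small`);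
the `C²`-perturbation estimate `IsMetricOn.abs_rmNormSqAt_le_of_flat_close` (Kotschwar 2014 (8),
`FlatQuietCollarExclusion`) bounds `|Rm|²_G(x)`, and `|Rm|²_G(x)` IS the Kretschmann scalar at `Ψ x`
(`rmNormSqAt_metricInCoords_eq_kretschmannAt`, chart independence). Everything is proved; no
definitions, no named facts.

## References

* B. Kotschwar, Comm. Anal. Geom. 22 (2014), §1.1 (8) (curvature difference identities). [Kotschwar2014]
* B. O'Neill, *Semi-Riemannian geometry* (1983), Ch. 3, Lemma 3.38, Prop. 3.41, Prop. 3.59. [ONeill1983]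
* M. Dafermos, G. Holzegel, I. Rodnianski, M. Taylor, arXiv:2104.08222, §1 (deviation from a
  background in late-time charts). [arXiv210408222]
-/

noncomputable section

-- instance search through nested operator types (as in `CoordCurvature`)
set_option maxSynthPendingDepth 3
-- deep operator types `E4 →L[ℝ] E4 →L[ℝ] E4 →L[ℝ] E4 →L[ℝ] ℝ` (as in `ADMEnergyPinning`)
set_option synthInstance.maxHeartbeats 200000

open Set Function Filter ContinuousLinearMap TopologicalSpace
open scoped Manifold ContDiff Topology ENNReal

universe u

namespace Literature.Geometry.Lorentzian

/-! ### The sharp operator of the Minkowski form -/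

namespace MetricCoord

/-- **`♯_η` in coordinates**: `♯_η α = −α(∂₀) ∂₀ + ∑ᵢ α(∂ᵢ) ∂ᵢ` (the inverse of
`η = diag(−1, 1, 1, 1)` is itself). [cite: ONeill1983, Ch. 3  p. 55] -/
theorem sharpAt_minkowski_apply (x : E4) (α : E4 →L[ℝ] ℝ) :
    sharpAt (fun _ : E4 ↦ Minkowski.bilin) x α =
      -(α (E4.basisVector 0)) • E4.basisVector 0 +
        ∑ i : Fin 3, α (E4.basisVector i.succ) • E4.basisVector i.succ := by
  refine sharpAt_eq_of_forall (G := fun _ : E4 ↦ Minkowski.bilin)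
    (isInvertible_of_nondegenerate Minkowski.bilin_nondegenerate) fun w ↦ ?_
  have hw : α w = ∑ μ : Fin 4, w μ * α (E4.basisVector μ) := by
    conv_lhs => rw [← (EuclideanSpace.basisFun (Fin 4) ℝ).sum_repr w]
    simp only [map_sum, map_smul, EuclideanSpace.basisFun_repr, EuclideanSpace.basisFun_apply,
      smul_eq_mul]
  have hsucc : ∀ (i : Fin 3) (w : E4), Minkowski.bilin (E4.basisVector i.succ) w = w i.succ := by
    intro i w
    fin_cases i <;> simp [Fin.sum_univ_three]
  have hsum : ∑ i : Fin 3, α (E4.basisVector i.succ) * w i.succ =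
      ∑ i : Fin 3, w i.succ * α (E4.basisVector i.succ) :=
    Finset.sum_congr rfl fun i _ ↦ mul_comm _ _
  rw [hw]
  conv_rhs => rw [Fin.sum_univ_succ]
  simp only [map_add, map_smul, map_sum, _root_.add_apply, _root_.smul_apply,
    FunLike.coe_sum, Finset.sum_apply, smul_eq_mul, Minkowski.bilin_basisVector_zero_left, hsucc]
  rw [hsum]
  ring

/-- **`‖♯_η‖ ≤ 4`** (crude: each of the four components of `♯_η α` is bounded by `‖α‖`).
[cite: ONeill1983, Ch. 3  p. 55] -/
theorem norm_sharpAt_minkowski_le (x : E4) : ‖sharpAt (fun _ : E4 ↦ Minkowski.bilin) x‖ ≤ 4 := by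
  refine ContinuousLinearMap.opNorm_le_bound _ (by norm_num) fun α ↦ ?_
  rw [sharpAt_minkowski_apply]
  have hb : ∀ μ : Fin 4, ‖E4.basisVector μ‖ = 1 := fun μ ↦ by
    simp [E4.basisVector]
  have hα : ∀ μ : Fin 4, ‖α (E4.basisVector μ)‖ ≤ ‖α‖ := fun μ ↦ by
    simpa [hb μ] using α.le_opNorm (E4.basisVector μ)
  calc ‖-(α (E4.basisVector 0)) • E4.basisVector 0 +
        ∑ i : Fin 3, α (E4.basisVector i.succ) • E4.basisVector i.succ‖
      ≤ ‖-(α (E4.basisVector 0)) • E4.basisVector 0‖ +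
          ‖∑ i : Fin 3, α (E4.basisVector i.succ) • E4.basisVector i.succ‖ := norm_add_le _ _
    _ ≤ ‖α‖ + ∑ _i : Fin 3, ‖α‖ := by
        refine add_le_add ?_ ((norm_sum_le _ _).trans (Finset.sum_le_sum fun i _ ↦ ?_))
        · rw [norm_smul, norm_neg, hb, mul_one]; exact hα 0
        · rw [norm_smul, hb, mul_one]; exact hα _
    _ = 4 * ‖α‖ := by
        simp only [Finset.sum_const, Finset.card_univ, Fintype.card_fin, nsmul_eq_mul]
        ring

end MetricCoord

/-! ### The curvature bound -/

namespace Spacetime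

open MetricCoord

variable (𝓢 : Spacetime.{u} 4)

/-- **An `ε`-flat chart sees only `O(ε²)` Kretschmann curvature** (pointwise jet form): for a smooth
chart `Ψ : ↥O → 𝓢` on an open `O ⊆ E4` and a point `x ∈ O` at which the `2`-jet of the deviation
`Ψ^* g − η` (zero-extended, `deviationExtend (Minkowski.backgroundOn O) Ψ`) has norm `≤ ε ≤ 1/16`
in every order `m ≤ 2`, `|Kretschmann(Ψ x)| ≤ 4⁵ · 42² · 8¹² · ε²`. [cite: Kotschwar2014, §1.1 (8)] -/
theorem abs_kretschmannAt_le_of_jets_deviationExtend_le {O : Opens E4} (Ψ : O → 𝓢.carrier)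
    (hΨ : ContMDiff 𝓘(ℝ, E4) (𝓡 4) ∞ Ψ) (x : O) {ε : ℝ} (hε0 : 0 ≤ ε) (hε : ε ≤ 16⁻¹)
    (hjet : ∀ m : ℕ, m ≤ 2 →
      ‖iteratedFDeriv ℝ m (𝓢.deviationExtend (Minkowski.backgroundOn O) Ψ) (x : E4)‖ ≤ ε) :
    |𝓢.kretschmannAt (Ψ x)| ≤ 4 ^ 5 * 42 ^ 2 * 8 ^ 12 * ε ^ 2 := by
  set B : ModelBackground := Minkowski.backgroundOn O with hB
  have hBd : (B.domain : Set E4) = (O : Set E4) := rfl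
  set ψ : E4 → 𝓢.carrier := Ψ ∘ (chartAt E4 x).symm with hψdef
  set G : E4 → E4 →L[ℝ] E4 →L[ℝ] ℝ := 𝓢.metricInCoords ψ with hGdef
  set F : E4 → E4 →L[ℝ] E4 →L[ℝ] ℝ := fun y ↦ G y - Minkowski.bilin with hFdef
  set D : E4 → E4 →L[ℝ] E4 →L[ℝ] ℝ := 𝓢.deviationExtend B Ψ with hDdef
  have hxO : (x : E4) ∈ (O : Set E4) := x.2
  -- smoothness of the parametrisation and of its components on `O`
  have hψ : ContMDiffOn 𝓘(ℝ, E4) (𝓡 4) ∞ ψ (O : Set E4) :=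
    𝓢.contMDiffOn_comp_chartAt_symm B Ψ x hΨ
  have hGsm : ContDiffOn ℝ ∞ G (O : Set E4) := 𝓢.contDiffOn_metricInCoords O.2 hψ
  -- the components minus `η` have the germ of the deviation at `x`
  have hgerm : F =ᶠ[𝓝 (x : E4)] D :=
    𝓢.metricInCoords_comp_chartAt_symm_sub_eventuallyEq B Ψ x hΨ hxO
  have hjetF : ∀ m : ℕ, m ≤ 2 → ‖iteratedFDeriv ℝ m F (x : E4)‖ ≤ ε := fun m hm ↦ by
    rw [(hgerm.iteratedFDeriv ℝ m).eq_of_nhds]; exact hjet m hm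
  -- order 0, 1, 2 at `x`
  have hd0 : ‖G x - Minkowski.bilin‖ ≤ ε := by
    have h := hjetF 0 (by norm_num)
    rwa [norm_iteratedFDeriv_zero] at h
  have hDF : fderiv ℝ G = fderiv ℝ F := by
    funext y; rw [hFdef]; exact (fderiv_sub_const _).symm
  have hd1 : ‖fderiv ℝ G x‖ ≤ ε := by
    have h := hjetF 1 (by norm_num)
    rwa [norm_iteratedFDeriv_one, ← hDF] at h
  have hd2 : ‖fderiv ℝ (fderiv ℝ G) x‖ ≤ ε := by
    have h := hjetF 2 le_rfl
    rwa [← norm_iteratedFDeriv_fderiv, norm_iteratedFDeriv_one, ← hDF] at h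
  -- the neighbourhood `V` of `x` on which the components are `C⁰`-pinched, hence nondegenerate
  set V : Set E4 := (O : Set E4) ∩ (fun y ↦ ‖G y - Minkowski.bilin‖) ⁻¹' Iio 1 with hVdef
  have hVopen : IsOpen V :=
    (hGsm.continuousOn.sub continuousOn_const).norm.isOpen_inter_preimage O.2 isOpen_Iio
  have hxV : (x : E4) ∈ V := ⟨hxO, lt_of_le_of_lt hd0 (by linarith)⟩
  have hVO : V ⊆ (O : Set E4) := inter_subset_left
  have hGmet : IsMetricOn G V :=
    { isOpen := hVopen
      contDiffOn := hGsm.mono hVO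
      symm := fun y _ v w ↦ 𝓢.metricInCoords_symm ψ y v w
      isInvertible := fun y hy ↦ isInvertible_of_nondegenerate
        (𝓢.metricInCoords_nondegenerate_of_norm_sub_lt_one hy.2) }
  have hηmet : IsMetricOn (fun _ : E4 ↦ Minkowski.bilin) V :=
    { isOpen := hVopen
      contDiffOn := contDiffOn_const
      symm := fun _ _ v w ↦ Minkowski.bilin_symm v w
      isInvertible := fun _ _ ↦ isInvertible_of_nondegenerate Minkowski.bilin_nondegenerate }
  -- the common bound `N = 8`
  have hsη : ‖sharpAt (fun _ : E4 ↦ Minkowski.bilin) (x : E4)‖ ≤ 8 :=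
    (norm_sharpAt_minkowski_le _).trans (by norm_num)
  have hsG : ‖sharpAt G (x : E4)‖ ≤ 8 := by
    have hsmall : ‖sharpAt (fun _ : E4 ↦ Minkowski.bilin) (x : E4)‖ *
        ‖Minkowski.bilin - G x‖ ≤ 2⁻¹ := by
      rw [norm_sub_rev]
      calc _ ≤ 4 * ε := mul_le_mul (norm_sharpAt_minkowski_le _) hd0 (norm_nonneg _) (by norm_num)
        _ ≤ 2⁻¹ := by linarith
    calc ‖sharpAt G (x : E4)‖ ≤ 2 * ‖sharpAt (fun _ : E4 ↦ Minkowski.bilin) (x : E4)‖ :=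
          norm_sharpAt_le_two_mul_of_small (G := fun _ : E4 ↦ Minkowski.bilin) (G' := G)
            (hηmet.isInvertible _ hxV) (hGmet.isInvertible _ hxV) hsmall
      _ ≤ 2 * 4 := by gcongr; exact norm_sharpAt_minkowski_le _
      _ = 8 := by norm_num
  have hε8 : ε ≤ 8 := by linarith
  have hDη : fderiv ℝ (fun _ : E4 ↦ Minkowski.bilin) =
      fun _ : E4 ↦ (0 : E4 →L[ℝ] E4 →L[ℝ] E4 →L[ℝ] ℝ) :=
    funext fun y ↦ fderiv_const_apply _
  have hDηx : fderiv ℝ (fun _ : E4 ↦ Minkowski.bilin) (x : E4) = 0 := fderiv_const_apply _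
  have hDDηx : fderiv ℝ (fderiv ℝ (fun _ : E4 ↦ Minkowski.bilin)) (x : E4) = 0 := by
    rw [hDη]; exact fderiv_const_apply _
  have h1' : ‖fderiv ℝ (fun _ : E4 ↦ Minkowski.bilin) (x : E4)‖ ≤ 8 := by
    rw [hDηx, norm_zero]; norm_num
  have hflat : ∀ X Y Z : E4, riemAt (fun _ : E4 ↦ Minkowski.bilin) (x : E4) X Y Z = 0 :=
    fun X Y Z ↦ riemAt_const _ _ X Y Z
  have hdd1 : ‖fderiv ℝ G x - fderiv ℝ (fun _ : E4 ↦ Minkowski.bilin) x‖ ≤ ε := by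
    rwa [hDηx, sub_zero]
  have hdd2 : ‖fderiv ℝ (fderiv ℝ G) x -
      fderiv ℝ (fderiv ℝ (fun _ : E4 ↦ Minkowski.bilin)) x‖ ≤ ε := by
    have h0 : fderiv ℝ (fderiv ℝ G) x - fderiv ℝ (fderiv ℝ (fun _ : E4 ↦ Minkowski.bilin)) x =
        fderiv ℝ (fderiv ℝ G) x := by
      rw [hDDηx]; exact sub_zero (fderiv ℝ (fderiv ℝ G) (x : E4))
    rw [h0]; exact hd2
  -- the `C²`-perturbation estimate
  have hK := hGmet.abs_rmNormSqAt_le_of_flat_close (EuclideanSpace.basisFun (Fin 4) ℝ) hηmet hxV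
    (N := 8) (δ := ε) (by norm_num) hε0 hsG hsη (hd1.trans hε8) h1' (hd2.trans hε8) hflat hd0
    hdd1 hdd2
  -- `|Rm|²` of the components IS the Kretschmann scalar at `Ψ x`
  have hKr : rmNormSqAt G (x : E4) = 𝓢.kretschmannAt (Ψ x) := by
    have h := 𝓢.rmNormSqAt_metricInCoords_eq_kretschmannAt O.2 hψ hxO
      (hGmet.isInvertible _ hxV)
    rw [h]
    congr 1
    show Ψ ((chartAt E4 x).symm (x : E4)) = Ψ x
    rw [show (chartAt E4 x).symm (x : E4) = x from Subtype.ext (OpensChart.chartAt_symm_val x hxO)]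
  rw [← hKr]
  refine hK.trans (le_of_eq ?_)
  simp only [Fintype.card_fin, finrank_euclideanSpace, Nat.cast_ofNat]
  ring

/-- **An `ε`-flat chart sees only `O(ε²)` Kretschmann curvature** (slab form, the vocabulary of
`FinalStateDecomposition`): if the `C²` deviation of the smooth chart `Ψ : ↥O → 𝓢` from the
Minkowski background over the slab `{x⁰ = τ} ∩ O` satisfies `deviationCk _ Ψ 2 τ ≤ ε ≤ 1/16`,
then `|Kretschmann(Ψ x)| ≤ 4⁵ · 42² · 8¹² · ε²` at every point `x` of that slab. Consequence for the
curvature wall: the late image of an `ε`-flat chart misses every region where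
`Kretschmann ≥ κ₀ > 4⁵ 42² 8¹² ε²`. [cite: Kotschwar2014, §1.1 (8)] -/
theorem abs_kretschmannAt_le_of_deviationCk_le {O : Opens E4} (Ψ : O → 𝓢.carrier)
    (hΨ : ContMDiff 𝓘(ℝ, E4) (𝓡 4) ∞ Ψ) {τ ε : ℝ} (hε0 : 0 ≤ ε) (hε : ε ≤ 16⁻¹)
    (hdev : 𝓢.deviationCk (Minkowski.backgroundOn O) Ψ 2 τ ≤ ENNReal.ofReal ε)
    {x : O} (hx : x ∈ (Minkowski.backgroundOn O).timeSlab τ) :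
    |𝓢.kretschmannAt (Ψ x)| ≤ 4 ^ 5 * 42 ^ 2 * 8 ^ 12 * ε ^ 2 := by
  refine 𝓢.abs_kretschmannAt_le_of_jets_deviationExtend_le Ψ hΨ x hε0 hε fun m hm ↦ ?_
  have h := (enorm_iteratedFDeriv_le_supCkENorm hm (mem_image_of_mem Subtype.val hx)
    (𝓢.deviationExtend (Minkowski.backgroundOn O) Ψ)).trans hdev
  rwa [← ofReal_norm, ENNReal.ofReal_le_ofReal_iff hε0] at h

end Spacetime

end Literature.Geometry.Lorentzian

end
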